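import Summits.HodgeConjecture.CorCM.Census.OcticWeilMultiDefect
import Summits.HodgeConjecture.CorCM.OcticCurveFourfoldWeilSixfold
import Summits.HodgeConjecture.CorCM.OcticWeilOrbitHodgeOfMarkman
import Summits.HodgeConjecture.CorCM.NonGaloisSexticCMFrame
import HarnessLib

/-!
# COR-CM — any number `r` of CM types over one OCTIC CM field `K ⊇ i(k)`: a FRAME `Hom(K, ℂ) ≃ Fin 4 × Bool` reading ANY family of types,
# and the transport of the `τ`-counts and of the INDEPENDENCE CRITERION to the frame

Cell `pub-hodgecm2` (COR-CM), seat b30 gen 25 (2026-08-23); count-neutral own lane OCTIC-MULTI (geometry half).  Theorems only; no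
definition, no named fact, no `sorry`, no geometry: the frame-side input of the intrinsic theorems of `CorCM/OcticWeilMultiHodgeOfMarkman.lean`
(the four-pair twins of gen 22/24's `DecicWeil23Pair.exists_frame₅`, `mem_iff_of_reading₅`, `DecicWeil23Multi.exists_frameM`,
`card_pos_of_frameM`, `indepPos_of_frameM`).

* `exists_frame₄` — for `[K:ℚ] = 8`, `i : k → K`, `Hom(k, ℂ) = {τ, τ̄}` an enumeration `e : Hom(K, ℂ) ≃ Fin 4 × Bool` with
  `(e s).2 = [s ∘ i = τ]` and `e s̄ = ((e s).1, ¬(e s).2)`;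
* `mem_iff_of_readingO` — a CM type from its reading on the labels `(a, true)`;
* **`exists_frameO`** — a frame reading ANY family `Φ : Fin r → CMType K` at positions `P m a = [e⁻¹(a, +) ∈ Φ_m]`:
  `s ∈ Φ_m ⟺ (e s).2 = P m (e s).1` (no normal form);
* `card_pos_of_frameO` (`#I_m = #{s over τ | s ∈ Φ_m}`), `indepPosO_of_frame` (the intrinsic criterion on the `τ`-fibre gives
  `Census.OcticWeilMulti.IndepPosO P`).
HONEST FRAMING: nothing about the Hodge conjecture is concluded here; `HC_CM` is not asserted.
[cite: Shimura1998, §18.2 Lemma (i)] [cite: MoonenZarhin1995Duke, Thm. 2.4]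

## References
* [Shimura1998] G. Shimura, *Abelian varieties with complex multiplication and modular functions*, §18.2 Lemma (i).
  [MoonenZarhin1995Duke] B. Moonen, Yu. Zarhin, Duke Math. J. 77 (1995), Thm. 2.4.
-/

noncomputable section

open NumberField

namespace Summit.HodgeConjecture.CorCM.OcticWeilMulti

open Literature.AlgebraicGeometry Literature.AlgebraicGeometry.Motives
open Summit.HodgeConjecture.CorCM.Census.OcticWeilMulti (IndepPosO)
open Summit.HodgeConjecture.CorCM.OcticCurveFourfold (card_filter_comp_eq_four)
open Summit.HodgeConjecture.CorCM.OcticWeilOrbit (card_filter_symm_true)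
open Summit.HodgeConjecture.CorCM.NonGaloisField (conjugate_comp)

open scoped Classical

/-! ## The frame: arbitrary positions; transport of the counts and of the independence criterion -/

section Frame

variable {K : Type} [Field K] [NumberField K] {k : Type} [Field k] [NumberField k] {r : ℕ}

/-- **THE FRAME EXISTS.**  For `[K:ℚ] = 8`, `i : k → K`, `Hom(k, ℂ) = {τ, τ̄}` there is an enumeration `e : Hom(K, ℂ) ≃ Fin 4 × Bool`
with `(e s).2 = [s ∘ i = τ]` and `e s̄ = ((e s).1, ¬(e s).2)`: number the four embeddings over `τ` and give `s̄` the number of `s` (the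
four-pair twin of gen 22's `DecicWeil23Pair.exists_frame₅`). [cite: Shimura1998, §18.2 Lemma (i)] -/
theorem exists_frame₄ (h8 : Module.finrank ℚ K = 8) (h2 : Module.finrank ℚ k = 2) (i : k →+* K) {τ : k →+* ℂ}
    (hττ : ComplexEmbedding.conjugate τ ≠ τ) (hk : ∀ σ : k →+* ℂ, σ = τ ∨ σ = ComplexEmbedding.conjugate τ) :
    ∃ e : (K →+* ℂ) ≃ Fin 4 × Bool, (∀ s, (e s).2 = true ↔ s.comp i = τ) ∧
      ∀ s, e (ComplexEmbedding.conjugate s) = ((e s).1, !(e s).2) := by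
  -- the four embeddings over `τ`
  set F : Finset (K →+* ℂ) := Finset.univ.filter fun s : K →+* ℂ => s.comp i = τ with hFdef
  have hF : F.card = 4 := card_filter_comp_eq_four i h8 h2 τ
  let g : {s // s ∈ F} ≃ Fin 4 := F.equivFinOfCardEq hF
  have hmemF : ∀ s : K →+* ℂ, s ∈ F ↔ s.comp i = τ := fun s => by simp [hFdef]
  -- over `τ̄` the conjugate lies over `τ`
  have hconj_over : ∀ s : K →+* ℂ, ¬ s.comp i = τ → (ComplexEmbedding.conjugate s).comp i = τ := by
    intro s hs
    rw [conjugate_comp, (hk (s.comp i)).resolve_left hs, ComplexEmbedding.involutive_conjugate]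
  have hconj_over' : ∀ s : K →+* ℂ, s.comp i = τ → ¬ (ComplexEmbedding.conjugate s).comp i = τ := by
    intro s hs h
    rw [conjugate_comp, hs] at h
    exact hττ h
  -- the enumeration
  let toF : (K →+* ℂ) → Fin 4 × Bool := fun s =>
    if h : s.comp i = τ then (g ⟨s, (hmemF s).2 h⟩, true)
    else (g ⟨ComplexEmbedding.conjugate s, (hmemF _).2 (hconj_over s h)⟩, false)
  let ofF : Fin 4 × Bool → (K →+* ℂ) := fun p =>
    if p.2 then (g.symm p.1).1 else ComplexEmbedding.conjugate (g.symm p.1).1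
  have hgF : ∀ a : Fin 4, ((g.symm a).1).comp i = τ := fun a => (hmemF _).1 (g.symm a).2
  have hcc : ∀ s : K →+* ℂ, ComplexEmbedding.conjugate (ComplexEmbedding.conjugate s) = s :=
    ComplexEmbedding.involutive_conjugate K
  have hgcongr : ∀ (s t : K →+* ℂ) (hs : s ∈ F) (ht : t ∈ F), s = t → g ⟨s, hs⟩ = g ⟨t, ht⟩ := by
    rintro s t hs ht rfl; rfl
  have htoF_pos : ∀ s (h : s.comp i = τ), toF s = (g ⟨s, (hmemF s).2 h⟩, true) := fun s h => dif_pos h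
  have htoF_neg : ∀ s (h : ¬ s.comp i = τ),
      toF s = (g ⟨ComplexEmbedding.conjugate s, (hmemF _).2 (hconj_over s h)⟩, false) := fun s h => dif_neg h
  have htoF_of : ∀ p, toF (ofF p) = p := by
    rintro ⟨a, b⟩
    cases b
    · have hof : ofF (a, false) = ComplexEmbedding.conjugate (g.symm a).1 := rfl
      have h : ¬ (ComplexEmbedding.conjugate (g.symm a).1).comp i = τ := hconj_over' _ (hgF a)
      rw [hof, htoF_neg _ h, Prod.mk.injEq]
      refine ⟨?_, rfl⟩
      rw [hgcongr _ _ _ (g.symm a).2 (hcc _), Subtype.coe_eta, Equiv.apply_symm_apply]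
    · have hof : ofF (a, true) = (g.symm a).1 := rfl
      rw [hof, htoF_pos _ (hgF a), Prod.mk.injEq]
      exact ⟨by rw [Subtype.coe_eta, Equiv.apply_symm_apply], rfl⟩
  have hof_toF : ∀ s, ofF (toF s) = s := by
    intro s
    by_cases h : s.comp i = τ
    · rw [htoF_pos s h]
      change (g.symm (g ⟨s, _⟩)).1 = s
      rw [Equiv.symm_apply_apply]
    · rw [htoF_neg s h]
      change ComplexEmbedding.conjugate (g.symm (g ⟨ComplexEmbedding.conjugate s, _⟩)).1 = s
      rw [Equiv.symm_apply_apply]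
      exact hcc s
  let e : (K →+* ℂ) ≃ Fin 4 × Bool := ⟨toF, ofF, hof_toF, htoF_of⟩
  have he : ∀ s, e s = toF s := fun _ => rfl
  refine ⟨e, fun s => ?_, fun s => ?_⟩
  · -- signs
    rw [he]
    by_cases h : s.comp i = τ
    · rw [htoF_pos s h]; exact ⟨fun _ => h, fun _ => rfl⟩
    · rw [htoF_neg s h]; exact ⟨fun h' => absurd h' Bool.false_ne_true, fun h' => absurd h' h⟩
  · -- conjugation
    rw [he, he]
    by_cases h : s.comp i = τ
    · have h' : ¬ (ComplexEmbedding.conjugate s).comp i = τ := hconj_over' s h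
      rw [htoF_pos s h, htoF_neg _ h', Prod.mk.injEq]
      exact ⟨hgcongr _ _ _ _ (hcc s), rfl⟩
    · have h' : (ComplexEmbedding.conjugate s).comp i = τ := hconj_over s h
      rw [htoF_neg s h, htoF_pos _ h']
      rfl

omit [NumberField K] [NumberField k] in
/-- **The type from its reading on the labels `(a, true)`**: if `e⁻¹(a, true) ∈ Φ ⟺ P a` then `s ∈ Φ ⟺ (e s).2 = P (e s).1`
(over `τ̄` read the conjugate: a CM type contains exactly one of `s, s̄`). [cite: Shimura1998, §18.2 Lemma (i)] -/
theorem mem_iff_of_readingO {e : (K →+* ℂ) ≃ Fin 4 × Bool}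
    (he_conj : ∀ s, e (ComplexEmbedding.conjugate s) = ((e s).1, !(e s).2)) {Φ : CMType K} {P : Fin 4 → Bool}
    (hP : ∀ a : Fin 4, e.symm (a, true) ∈ Φ.1 ↔ P a = true) (s : K →+* ℂ) :
    s ∈ Φ.1 ↔ (e s).2 = P (e s).1 := by
  have key := hP (e s).1
  cases h2s : (e s).2
  · -- `s` lies over `τ̄`: read its conjugate, which is `e⁻¹((e s).1, true)`
    have hs : ComplexEmbedding.conjugate s = e.symm ((e s).1, true) := by
      apply e.injective
      rw [he_conj, Equiv.apply_symm_apply, h2s]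
      rfl
    rw [← hs] at key
    rw [Φ.2 s, key]
    cases P (e s).1 <;> simp
  · have hs : s = e.symm ((e s).1, true) := by
      apply e.injective
      rw [Equiv.apply_symm_apply]
      exact Prod.ext rfl h2s
    rw [← hs] at key
    rw [key]
    cases P (e s).1 <;> simp

/-- **THE FRAME READING ANY FAMILY OF TYPES (no normal form).**  For `[K:ℚ] = 8`, `i : k → K`, `Hom(k, ℂ) = {τ, τ̄}` and ANY family
`Φ : Fin r → CMType K`: an enumeration `e : Hom(K, ℂ) ≃ Fin 4 × Bool` with `(e s).2 = [s ∘ i = τ]`, `e s̄ = ((e s).1, ¬(e s).2)`, and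
positions `P m a = [e⁻¹(a, +) ∈ Φ_m]` reading every type: `s ∈ Φ_m ⟺ (e s).2 = P m (e s).1`. [cite: Shimura1998, §18.2 Lemma (i)] -/
theorem exists_frameO (h8 : Module.finrank ℚ K = 8) (h2 : Module.finrank ℚ k = 2) (i : k →+* K) {τ : k →+* ℂ}
    (hττ : ComplexEmbedding.conjugate τ ≠ τ) (hk : ∀ σ : k →+* ℂ, σ = τ ∨ σ = ComplexEmbedding.conjugate τ)
    (Φ : Fin r → CMType K) :
    ∃ (e : (K →+* ℂ) ≃ Fin 4 × Bool) (P : Fin r → Fin 4 → Bool), (∀ s, (e s).2 = true ↔ s.comp i = τ) ∧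
      (∀ s, e (ComplexEmbedding.conjugate s) = ((e s).1, !(e s).2)) ∧
      (∀ (m : Fin r) (a : Fin 4), P m a = true ↔ e.symm (a, true) ∈ (Φ m).1) ∧
      ∀ (m : Fin r) (s : K →+* ℂ), s ∈ (Φ m).1 ↔ (e s).2 = P m (e s).1 := by
  obtain ⟨e, he_sign, he_conj⟩ := exists_frame₄ h8 h2 i hττ hk
  let J : Fin r → Finset (Fin 4) := fun m => Finset.univ.filter fun a => e.symm (a, true) ∈ (Φ m).1
  have hJ : ∀ (m : Fin r) (a : Fin 4), a ∈ J m ↔ e.symm (a, true) ∈ (Φ m).1 := fun m a => by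
    simp only [J, Finset.mem_filter, Finset.mem_univ, true_and]
  refine ⟨e, fun (m : Fin r) (a : Fin 4) => decide (a ∈ J m), he_sign, he_conj, fun m a => by rw [decide_eq_true_iff, hJ],
    fun m s => ?_⟩
  exact mem_iff_of_readingO (Φ := Φ m) (P := fun a : Fin 4 => decide (a ∈ J m)) he_conj
    (fun a => by rw [decide_eq_true_iff, hJ]) s

variable {e : (K →+* ℂ) ≃ Fin 4 × Bool} {P : Fin r → Fin 4 → Bool} {i : k →+* K} {τ : k →+* ℂ} {Φ : Fin r → CMType K}
  (he_sign : ∀ s, (e s).2 = true ↔ s.comp i = τ) (hP : ∀ (m : Fin r) (a : Fin 4), P m a = true ↔ e.symm (a, true) ∈ (Φ m).1)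

omit [NumberField k] in
include he_sign hP in
/-- **The `τ`-count in the frame**: `#I_m = #{a | P m a} = #{s over τ | s ∈ Φ_m}`. [folklore] -/
theorem card_pos_of_frameO (m : Fin r) : ((Finset.univ : Finset (Fin 4)).filter fun a => P m a = true).card =
    (Finset.univ.filter fun s : K →+* ℂ => s.comp i = τ ∧ s ∈ (Φ m).1).card := by
  rw [Finset.filter_congr fun a _ => hP m a]
  convert card_filter_symm_true he_sign (fun s => s ∈ (Φ m).1) using 2

omit [NumberField K] [NumberField k] in
include he_sign hP in
/-- **The independence criterion in the frame**: the intrinsic criterion on the `τ`-fibre (`hInd`) gives `IndepPosO P` (read the four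
embeddings over `τ` as `e⁻¹(a, +)`, `a < 4`). [folklore] -/
theorem indepPosO_of_frame
    (hInd : ∀ (w : ℤ) (t : Fin r → ℤ), (∀ s : K →+* ℂ, s.comp i = τ → w + ∑ m : Fin r, (if s ∈ (Φ m).1 then t m else 0) = 0) →
      w = 0 ∧ ∀ m, t m = 0) : IndepPosO P := by
  intro w t h
  refine hInd w t fun s hs => ?_
  have h2 : (e s).2 = true := (he_sign s).2 hs
  have hs' : e.symm ((e s).1, true) = s := by
    rw [show ((e s).1, true) = e s from Prod.ext rfl h2.symm, Equiv.symm_apply_apply]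
  have key := h (e s).1
  have hiff : ∀ m : Fin r, P m (e s).1 = true ↔ s ∈ (Φ m).1 := fun m => by rw [hP, hs']
  rw [Finset.sum_congr rfl fun m _ => show (if P m (e s).1 then t m else 0) = if s ∈ (Φ m).1 then t m else 0 by
    by_cases hm : P m (e s).1 = true
    · rw [if_pos hm, if_pos ((hiff m).1 hm)]
    · rw [if_neg hm, if_neg fun h' => hm ((hiff m).2 h')]] at key
  exact key

end Frame

end Summit.HodgeConjecture.CorCM.OcticWeilMulti

end
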